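/-
Copyright: lit-balaban cell, Phase-2 proof seat p02 (gen 8).  Statement-level skeleton of a published paper; no proof claims beyond what
the kernel checks below.
-/
import Literature.MathematicalPhysics.QuantumFieldTheory.BalabanImbrieJaffe1984to88.BIJ88ExteriorForms5121
import Literature.MathematicalPhysics.QuantumFieldTheory.BalabanImbrieJaffe1984to88.BIJ88Sect2Statements

/-!
# `BalabanImbrieJaffe1984to88.BIJ88W5XBound5121` — T. Bałaban, J. Imbrie, A. Jaffe, *Effective action and cluster properties of the abelian
Higgs model*, Commun. Math. Phys. **114** (1988) 257–315 [BalabanImbrieJaffe1988]: p. 302 [PDF 46], **THE BOUND `|W₅^{(k)}(X)| ≦ e^{−cr(e_k)|X|}`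
FOR THE `W₅` OF RECORD** (`BIJ88ExteriorForms5121.W5`, p02 g6 v1.1 p264325: minus the `X`-parts `½⟨v_φ, C_{Λ₁₀,X}v_φ⟩ + ½⟨v_A, C_{Λ^{c*c},X}v_A⟩`
of the third and fifth quadratic forms of (5.12.1) under the random-walk expansions (2.45)/(2.48) of the two covariances) — PROVED from the
printed estimate **(2.46)** for the two families `C_{Λ₁₀,X}(u_{k+1})`, `C_{Λ^{c*c}₁₀,X}` (r18's typed `BIJ88Sect2Statements.Ineq246`: support in
`X × X` and `|C_X(x₁,x₂)| ≦ e^{−cr(e_k)|X|}`), field sizes `|v_φ| ≤ p_φ`, `|v_A| ≤ p_A` and at most `N·|X|` field sites in `X`: explicitly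
`|W₅(X)| ≤ ½((N_φ|X|)²p_φ² + (N_A|X|)²p_A²)e^{−cr(e_k)|X|}` (`abs_W5_le_explicit`), hence **`|W₅(X)| ≤ e^{−(c/2)r(e_k)|X|}` for every `X` once
`r(e_k) ≥ (2/c)(2 + N_φ²p_φ² + N_A²p_A²)`** (`abs_W5_le`) — *"powers of p(e_k) are absorbed by e^{−cr(e_k)}"* (p. 290), the regime of p36's
`BIJ88SmallCoupling23.eventually_pLog_pow_le_exp_rLen`.  This is the one unproved printed claim of SKELETON row **C2.Eq5.12.1-5.12.7** named by
the owner's display audit (r16 g8, ROWS-C2-part2 v2.54: *"FLIP CONDITION: |W₅^{(k)}(X)| ≦ e^{−cr(e_k)|X|} as a theorem for the W₅ of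
`BIJ88ExteriorForms5121` (v1.1 `W5`) from the (2.45)/(2.48) random-walk expansions of the two covariances … model or torus instance of record"*).

statement-level skeleton of published theorems with citation tags; proofs where landed; nothing here is a claim about the Yang–Mills mass gap

PDF held: `paper:balaban1988-cmp114-bij-abelian-higgs-effective-action` (journal page = PDF page + 256); p. 302 [PDF 46] as quoted verbatim in
`BIJ88ExteriorForms5121` (p02 g6, read then as an image) and in r16's v2.54 audit (image `renders/cmp114/original-p046-x2.png`); p. 264 [PDF 8]
(2.45)–(2.46) through r18's verbatim docstrings of `Eq245`/`Ineq246`.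

CITATION HEADER (lean-in-tree rule).  Part of the lit-balaban TYPED SKELETON (HOME `run/shared/lean/pub/lit-balaban/`), Phase-2 proof seat p02
(gen 8), unit `lit-balaban-p02-g8`; WHAT IS REPRODUCED = the p. 302 sentence of SKELETON row **C2.Eq5.12.1-5.12.7** (owner r16, referee ref-5),
kind «model instance» in the finite-dimensional Gaussian model of `BIJ88ExteriorForms5121` (covariances as real matrices over finite index types,
the connected unions `X` of `r(e_k)`-cubes as an index type `J` with cube count `ncubes`).  Decls of record used BY NAME (nothing restated):
`BIJ88ExteriorForms5121.W5`/`halfQuad` (p02 g6), `BIJ88Sect2Statements.Ineq246` (r18).  No TAKING collision: HOME/STATUS.md and FILED.md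
grep'd for «W5»/«5.12» in the minute before filing (the tree's `BIJ88W5Bound549` is p08 g4's bound for the kernel `w₅` of (5.4.9), a
different object).

THE PRINTED TEXT (p. 302 [PDF 46], verbatim, as quoted in `BIJ88ExteriorForms5121`): *"We remove the nonlocality in the third and fifth
quadratic forms with random walk expansions for C^{(k)}_{Λ^{(k)}_{10}}(u_{k+1}) and for C^{(k)}_{Λ^{(k)c*c}_{10}} as in (2.45) and (2.48). These
obey the usual estimates. We denote the first and second quadratic forms by 𝒬₇, and the other three [with …] by 𝒬₈. Altogether the
exponential in (5.12.1) has been written as exp[−𝒬₇ − 𝒬₈ − Σ_X W₅^{(k)}(X)]. Here W₅^{(k)}(X) contains the terms with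
C^{(k)}_{Λ^{(k)}_{10},X}(u_{k+1}) or with C^{(k)}_{Λ^{(k)c*c}_{10},X}, and satisfies |W₅^{(k)}(X)| ≦ e^{−cr(e_k)|X|}."*  (2.46) p. 264: *"The operator
C^{(k)}_{Λ,X}(u) depends only on u in X. It vanishes unless both arguments are in X, and is estimated as follows: |C^{(k)}_{Λ,X}(u;x₁,x₂)| ≦
e^{−cr(e_k)|X|}. (2.46) Here and elsewhere, |X| refers to the number of r(e_k)-cubes in X, not the volume of X."*

THE READING.  `W₅(X) = −(½⟨v_φ, C_{φ,X}v_φ⟩ + ½⟨v_A, C_{A,X}v_A⟩)` (`W5`, the sign of `exp[−… − Σ_XW₅(X)]`), `v_φ = Λ₁₀ΔΛ^c₁₀φ` and `v_A` = the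
vector of (5.12.5) — fields of the small-field region, `|v_φ| ≤ p_φ`, `|v_A| ≤ p_A` (multiples of `p(e_k)`, pp. 273/290); the field sites of
the region lying in `X` number at most `N_φ|X|` resp. `N_A|X|` (`N` = sites resp. bonds per `r(e_k)`-cube: `r(e_k)^d`, `d·r(e_k)^d`) — typed by
support finsets `S_φ(X) ⊇ {i : mem_φ i X}`, `S_A(X)` with `|S_φ(X)| ≤ N_φ·ncubes X`; (2.46) for both families with one pair `(c, r(e_k))`.

WHAT IS PROVED (0 `sorry`, standard axioms; theorems only — proof lane):
* §1 `sum_abs_le_card_mul` (a function vanishing off a finset `S` with `|g| ≤ c` has `Σ|g| ≤ |S|·c`), **`abs_halfQuad_le`** (`|½⟨v, Cv⟩| ≤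
  ½|S|²p²ε` for `C` supported in `S × S` with `|C| ≤ ε`, `|v| ≤ p`).
* §2 **`abs_W5_le_explicit`** (`|W₅(X)| ≤ ½((N_φ·|X|)²p_φ² + (N_A·|X|)²p_A²)·e^{−cr(e_k)|X|}` from (2.46) for both families) and **`abs_W5_le`**
  (THE PRINTED FORM: `|W₅(X)| ≤ e^{−(c/2)r(e_k)|X|}` for EVERY `X`, once `r(e_k) ≥ (2/c)(2 + N_φ²p_φ² + N_A²p_A²)`; `|X| = 0` is trivial, else
  `|X|² ≤ e^{2|X|}` and `B|X| ≤ e^{B|X|}`).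
HONEST SCOPE.  (i) Model instance: the two (2.46) estimates enter as displayed hypotheses (row C2.Eq2.46's typed `Ineq246`, for the families
`C_{Λ₁₀,X}(u_{k+1})`, `C_{Λ^{c*c}₁₀,X}`), exactly as the print derives the claim (*"These obey the usual estimates"*); the expansions (2.45)/(2.48)
themselves are the identities consumed by `BIJ88ExteriorForms5121.exponent5121_regroup`.  (ii) Real finite-dimensional carriers (the
`B2Eq228Conditioning` model of the row's files); the field bounds and the per-cube site counts are hypotheses with explicit constants; the rate
halves (`c ↦ c/2`), print's `c` changes line to line.  (iii) No `def`, no new named fact; NOT summit progress.  Unit `lit-balaban-p02-g8`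
(literature-prover-lit-balaban-p02-g8-0), 2026-08-21.
-/

open scoped BigOperators
open Finset Matrix

namespace Literature.MathematicalPhysics.QuantumFieldTheory.BalabanImbrieJaffe1984to88.BIJ88W5XBound5121

open BIJ88ExteriorForms5121 (halfQuad W5)
open BIJ88Sect2Statements (Ineq246)

noncomputable section

/-! ## §1  A quadratic form with a small, supported kernel -/

/-- a function vanishing off `S` with `|g| ≤ c` on `S` has `Σ_j |g j| ≤ |S|·c`. [folklore] -/
private theorem sum_abs_le_card_mul {m : Type} [Fintype m] (S : Finset m) (g : m → ℝ) {c : ℝ}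
    (h0 : ∀ j, j ∉ S → g j = 0) (hb : ∀ j ∈ S, |g j| ≤ c) : ∑ j, |g j| ≤ S.card * c := by
  classical
  have h1 : ∑ j, |g j| = ∑ j ∈ S, |g j| := by
    rw [← Finset.sum_subset (Finset.subset_univ S)]
    intro j _ hj
    rw [h0 j hj, abs_zero]
  rw [h1]
  calc ∑ j ∈ S, |g j| ≤ ∑ j ∈ S, c := Finset.sum_le_sum hb
    _ = S.card * c := by rw [Finset.sum_const, nsmul_eq_mul]

/-- **`|½⟨v, Cv⟩| ≤ ½·|S|²·p²·ε`** for a kernel `C` supported in `S × S` with `|C(i,j)| ≤ ε` and a field `|v| ≤ p` — the size of one `X`-term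
of the third/fifth form of (5.12.1). [cite: BalabanImbrieJaffe1988, (5.12.1) p.302] -/
theorem abs_halfQuad_le {m : Type} [Fintype m] (C : Matrix m m ℝ) (v : m → ℝ) {S : Finset m} {ε p : ℝ} (hε : 0 ≤ ε)
    (hsupp : ∀ i j, ¬ (i ∈ S ∧ j ∈ S) → C i j = 0) (hC : ∀ i j, |C i j| ≤ ε) (hv : ∀ i, |v i| ≤ p) :
    |halfQuad C v| ≤ 1 / 2 * (S.card : ℝ) ^ 2 * p ^ 2 * ε := by
  unfold halfQuad
  rw [abs_mul, abs_of_pos (by norm_num : (0 : ℝ) < 1 / 2)]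
  simp only [dotProduct, mulVec]
  -- the inner sums: `|Σ_j C(i,j)v(j)| ≤ |S|·(ε·p)`, vanishing for `i ∉ S`
  have inner : ∀ i ∈ S, |∑ j, C i j * v j| ≤ S.card * (ε * p) := by
    intro i _
    refine (Finset.abs_sum_le_sum_abs _ _).trans (sum_abs_le_card_mul S (fun j => C i j * v j) ?_ ?_)
    · intro j hj
      rw [hsupp i j (fun h => hj h.2), zero_mul]
    · intro j _
      rw [abs_mul]
      exact mul_le_mul (hC i j) (hv j) (abs_nonneg _) hε
  have outer : ∑ i, |v i * ∑ j, C i j * v j| ≤ S.card * (p * (S.card * (ε * p))) := by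
    refine sum_abs_le_card_mul S (fun i => v i * ∑ j, C i j * v j) ?_ ?_
    · intro i hi
      have h0 : ∀ j, C i j = 0 := fun j => hsupp i j (fun h => hi h.1)
      simp only [h0, zero_mul, Finset.sum_const_zero, mul_zero]
    · intro i hi
      have hp : 0 ≤ p := (abs_nonneg _).trans (hv i)
      rw [abs_mul]
      exact mul_le_mul (hv i) (inner i hi) (abs_nonneg _) hp
  calc 1 / 2 * |∑ i, v i * ∑ j, C i j * v j| ≤ 1 / 2 * ∑ i, |v i * ∑ j, C i j * v j| :=
        mul_le_mul_of_nonneg_left (Finset.abs_sum_le_sum_abs _ _) (by norm_num)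
    _ ≤ 1 / 2 * (S.card * (p * (S.card * (ε * p)))) := mul_le_mul_of_nonneg_left outer (by norm_num)
    _ = 1 / 2 * (S.card : ℝ) ^ 2 * p ^ 2 * ε := by ring

/-! ## §2  `|W₅^{(k)}(X)| ≦ e^{−cr(e_k)|X|}` -/

/-- **`|W₅(X)| ≤ ½((N_φ|X|)²p_φ² + (N_A|X|)²p_A²)·e^{−cr(e_k)|X|}`** — from (2.46) for the two families `C_{Λ₁₀,X}(u_{k+1})`, `C_{Λ^{c*c}₁₀,X}`
(support in `X × X`, `|C_X| ≤ e^{−cr(e_k)|X|}`), the field sizes `|v_φ| ≤ p_φ`, `|v_A| ≤ p_A`, and at most `N_φ|X|`, `N_A|X|` field sites of the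
region in `X`. [cite: BalabanImbrieJaffe1988, (5.12.1) p.302] -/
theorem abs_W5_le_explicit {mφ mA J : Type} [Fintype mφ] [Fintype mA] {CφX : J → Matrix mφ mφ ℝ} {CAX : J → Matrix mA mA ℝ}
    {ncubes : J → ℕ} {memφ : mφ → J → Prop} {memA : mA → J → Prop} {c rek : ℝ}
    (hφ : Ineq246 ncubes memφ CφX c rek) (hA : Ineq246 ncubes memA CAX c rek)
    {Sφ : J → Finset mφ} {SA : J → Finset mA} (hSφ : ∀ i X, memφ i X → i ∈ Sφ X) (hSA : ∀ a X, memA a X → a ∈ SA X)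
    {Nφ NA : ℕ} (hNφ : ∀ X, (Sφ X).card ≤ Nφ * ncubes X) (hNA : ∀ X, (SA X).card ≤ NA * ncubes X)
    {vφ : mφ → ℝ} {vA : mA → ℝ} {pφ pA : ℝ} (hvφ : ∀ i, |vφ i| ≤ pφ) (hvA : ∀ a, |vA a| ≤ pA) (X : J) :
    |W5 CφX CAX vφ vA X| ≤
      1 / 2 * (((Nφ * ncubes X : ℕ) : ℝ) ^ 2 * pφ ^ 2 + ((NA * ncubes X : ℕ) : ℝ) ^ 2 * pA ^ 2) *
        Real.exp (-c * rek * ncubes X) := by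
  have hE : 0 ≤ Real.exp (-c * rek * ncubes X) := (Real.exp_pos _).le
  have h1 := abs_halfQuad_le (CφX X) vφ (S := Sφ X) hE
    (fun i j hij => hφ.1 X i j fun h => hij ⟨hSφ i X h.1, hSφ j X h.2⟩) (fun i j => hφ.2 X i j) hvφ
  have h2 := abs_halfQuad_le (CAX X) vA (S := SA X) hE
    (fun a b hab => hA.1 X a b fun h => hab ⟨hSA a X h.1, hSA b X h.2⟩) (fun a b => hA.2 X a b) hvA
  have hc1 : ((Sφ X).card : ℝ) ≤ ((Nφ * ncubes X : ℕ) : ℝ) := by exact_mod_cast hNφ X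
  have hc2 : ((SA X).card : ℝ) ≤ ((NA * ncubes X : ℕ) : ℝ) := by exact_mod_cast hNA X
  unfold W5
  rw [abs_neg]
  refine (abs_add_le _ _).trans ?_
  calc |halfQuad (CφX X) vφ| + |halfQuad (CAX X) vA|
      ≤ 1 / 2 * ((Sφ X).card : ℝ) ^ 2 * pφ ^ 2 * Real.exp (-c * rek * ncubes X) +
          1 / 2 * ((SA X).card : ℝ) ^ 2 * pA ^ 2 * Real.exp (-c * rek * ncubes X) := add_le_add h1 h2
    _ ≤ 1 / 2 * ((Nφ * ncubes X : ℕ) : ℝ) ^ 2 * pφ ^ 2 * Real.exp (-c * rek * ncubes X) +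
          1 / 2 * ((NA * ncubes X : ℕ) : ℝ) ^ 2 * pA ^ 2 * Real.exp (-c * rek * ncubes X) := by gcongr
    _ = _ := by ring

/-- **`|W₅^{(k)}(X)| ≦ e^{−cr(e_k)|X|}` (p. 302) FOR THE `W₅` OF RECORD** — with the rate halved: for EVERY `X`,
`|W₅(X)| ≤ e^{−(c/2)r(e_k)|X|}` as soon as `r(e_k) ≥ (2/c)(2 + N_φ²p_φ² + N_A²p_A²)` (*"powers of p(e_k) are absorbed by e^{−cr(e_k)}"*):
from `abs_W5_le_explicit` by `|X|² ≤ e^{2|X|}`, `B/2 ≤ e^{B|X|}` (`|X| ≥ 1`; `|X| = 0` is trivial). [cite: BalabanImbrieJaffe1988, (5.12.1) p.302] -/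
theorem abs_W5_le {mφ mA J : Type} [Fintype mφ] [Fintype mA] {CφX : J → Matrix mφ mφ ℝ} {CAX : J → Matrix mA mA ℝ}
    {ncubes : J → ℕ} {memφ : mφ → J → Prop} {memA : mA → J → Prop} {c rek : ℝ}
    (hφ : Ineq246 ncubes memφ CφX c rek) (hA : Ineq246 ncubes memA CAX c rek)
    {Sφ : J → Finset mφ} {SA : J → Finset mA} (hSφ : ∀ i X, memφ i X → i ∈ Sφ X) (hSA : ∀ a X, memA a X → a ∈ SA X)
    {Nφ NA : ℕ} (hNφ : ∀ X, (Sφ X).card ≤ Nφ * ncubes X) (hNA : ∀ X, (SA X).card ≤ NA * ncubes X)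
    {vφ : mφ → ℝ} {vA : mA → ℝ} {pφ pA : ℝ} (hvφ : ∀ i, |vφ i| ≤ pφ) (hvA : ∀ a, |vA a| ≤ pA) (hc : 0 < c)
    (hrek : 2 / c * (2 + ((Nφ : ℝ) ^ 2 * pφ ^ 2 + (NA : ℝ) ^ 2 * pA ^ 2)) ≤ rek) (X : J) :
    |W5 CφX CAX vφ vA X| ≤ Real.exp (-(c / 2) * rek * ncubes X) := by
  have h := abs_W5_le_explicit hφ hA hSφ hSA hNφ hNA hvφ hvA X
  set B : ℝ := (Nφ : ℝ) ^ 2 * pφ ^ 2 + (NA : ℝ) ^ 2 * pA ^ 2 with hBdef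
  have hB : 0 ≤ B := by positivity
  have hrek' : 2 + B ≤ c / 2 * rek := by
    rw [div_mul_eq_mul_div, div_le_iff₀ hc] at hrek
    linarith
  by_cases hn : ncubes X = 0
  · have h0 : |W5 CφX CAX vφ vA X| ≤ 0 := by simpa [hn] using h
    exact h0.trans (Real.exp_pos _).le
  · have hn1 : (1 : ℝ) ≤ (ncubes X : ℝ) := by exact_mod_cast Nat.one_le_iff_ne_zero.2 hn
    have hn0 : (0 : ℝ) ≤ (ncubes X : ℝ) := Nat.cast_nonneg _
    -- `n² ≤ e^{2n}` and `B/2 ≤ e^{Bn}`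
    have e1 : (ncubes X : ℝ) ^ 2 ≤ Real.exp (2 * ncubes X) := by
      have h3 : (ncubes X : ℝ) ≤ Real.exp (ncubes X) := by linarith [Real.add_one_le_exp (ncubes X : ℝ)]
      calc (ncubes X : ℝ) ^ 2 ≤ Real.exp (ncubes X) ^ 2 := pow_le_pow_left₀ hn0 h3 2
        _ = Real.exp (2 * ncubes X) := by rw [sq, ← Real.exp_add]; ring_nf
    have e2 : B / 2 ≤ Real.exp (B * ncubes X) := by
      have h4 : B * ncubes X + 1 ≤ Real.exp (B * ncubes X) := Real.add_one_le_exp _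
      nlinarith
    calc |W5 CφX CAX vφ vA X|
        ≤ 1 / 2 * (((Nφ * ncubes X : ℕ) : ℝ) ^ 2 * pφ ^ 2 + ((NA * ncubes X : ℕ) : ℝ) ^ 2 * pA ^ 2) *
            Real.exp (-c * rek * ncubes X) := h
      _ = (ncubes X : ℝ) ^ 2 * (B / 2) * Real.exp (-c * rek * ncubes X) := by
          rw [hBdef]; push_cast; ring
      _ ≤ Real.exp (2 * ncubes X) * Real.exp (B * ncubes X) * Real.exp (-c * rek * ncubes X) :=
          mul_le_mul_of_nonneg_right (mul_le_mul e1 e2 (by positivity) (Real.exp_pos _).le) (Real.exp_pos _).le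
      _ = Real.exp ((2 + B) * ncubes X - c * rek * ncubes X) := by
          rw [← Real.exp_add, ← Real.exp_add]; ring_nf
      _ ≤ Real.exp (-(c / 2) * rek * ncubes X) := by
          refine Real.exp_le_exp.2 ?_
          have h5 := mul_le_mul_of_nonneg_right hrek' hn0
          nlinarith

end

end Literature.MathematicalPhysics.QuantumFieldTheory.BalabanImbrieJaffe1984to88.BIJ88W5XBound5121
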